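import Literature.NumberTheory.EllipticCurves.NewformCountMartinBoundProofs
import Literature.NumberTheory.EllipticCurves.NewformsStrongMultiplicityOne
import HarnessLib

/-!
# von Känel–Matschke, §10.5.1: `α(m) ≤ α(n)` for `m ∣ n` — PROVED

Topic `Literature/NumberTheory/EllipticCurves` (family `abc`, LADDER-ABC A1: the *modular method*).
A proofs-only companion (theorems only; NO definition, NO new named fact, nothing restated; D-0026)
of `HeightConductorBoundsModularity.lean`, for R. von Känel, B. Matschke, arXiv:1605.06079 =
Mem. AMS **286** (2023) no. 1419 [`VonkanelMatschke2023`], §10.5.1, proof of Prop. 10.7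
(`prop:algobounds`): *"We observe that `α(m) ≤ α(n)` for all `m, n` in `ℤ_{≥ 1}` with `m` dividing
`n`."* — the monotonicity under divisibility of the quantity `α = min(β, β*)` of (10.x) `def:bb*`
(`vkmAlpha`), which is the only additional input of Prop. 10.7 over the proofs of Props. 10.1/10.6.

Over the tree: `m(M) ≤ m(N)` (divisors of `M` are divisors of `N`), `l(M) ≤ l(N)` and
`l*(M) ≤ l*(N)` (`ψ(M) ≤ ψ(N)`, termwise on the factorisation), and **`g(X₀(M)) ≤ g(X₀(N))`** from
`dim S₂(Γ₀(·)) = g(X₀(·))` (`finrank_cuspForm_two_eq_genusX0_holds`) and the injective inclusion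
`S₂(Γ₀(M)) ↪ S₂(Γ₀(N))` (`degeneracyMap0_one_injective`, finite-dimensionality by
`finiteDimensional_cuspForm_gamma0`); the `max_J`-term is monotone in both its arguments.

No `abc` claim; typed ≠ endorsed. All theorems; axioms standard.

## References

* R. von Känel, B. Matschke, arXiv:1605.06079 (2016) = Mem. AMS 286 (2023), §10.5.1 (proof of
  Prop. 10.7). [VonkanelMatschke2023]
-/

noncomputable section

open Finset Real CongruenceSubgroup
open scoped MatrixGroups

namespace Literature.NumberTheory.EllipticCurves.ModularForms

/-! ### The ingredients `m`, `l`, `l*`, `g` are monotone under divisibility -/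

/-- `m(M) ≤ m(N)` for `M ∣ N` (`N ≥ 1`): the newforms of level dividing `M` are among those of level
dividing `N`. [cite: VonkanelMatschke2023, §10.5.1 (proof of Prop. 10.7)] -/
theorem newformCount_le_of_dvd {M N : ℕ} (h : M ∣ N) (hN : N ≠ 0) :
    newformCount M ≤ newformCount N := by
  classical
  let n : ℕ → ℕ := fun M ↦ if h : M = 0 then 0 else @Nat.card ↥(@newforms0 M ⟨h⟩ 2)
  have hn : ∀ (M : ℕ) [NeZero M], n M = Nat.card ↥(newforms0 M 2) := fun M _ ↦ by
    simp only [n, dif_neg (NeZero.ne M)]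
  rw [newformCount_eq_sum_divisors M n hn, newformCount_eq_sum_divisors N n hn]
  exact Finset.sum_le_sum_of_subset_of_nonneg (Nat.divisors_subset_of_dvd hN h)
    fun _ _ _ ↦ Nat.zero_le _

/-- `l(M) ≤ l(N)` for `M ∣ N` (`N ≥ 1`). [cite: VonkanelMatschke2023, §10.5.1 (proof of Prop. 10.7)] -/
theorem vkmIndexL_le_of_dvd {M N : ℕ} (h : M ∣ N) (hN : N ≠ 0) : vkmIndexL M ≤ vkmIndexL N := by
  unfold vkmIndexL
  apply Nat.div_le_div_right
  have h1 : M ≤ N := Nat.le_of_dvd (Nat.pos_of_ne_zero hN) h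
  have h2 : ∏ p ∈ M.primeFactors, (p + 1) ≤ ∏ p ∈ N.primeFactors, (p + 1) :=
    Finset.prod_le_prod_of_subset_of_one_le' (Nat.primeFactors_mono h hN)
      fun p _ _ ↦ Nat.succ_le_succ (Nat.zero_le p)
  exact Nat.mul_le_mul h1 h2

/-- `ψ(M) ≤ ψ(N)` for `M ∣ N` (`N ≥ 1`), termwise on `ψ(N) = ∏_{p^e ∥ N} p^{e−1}(p+1)` (as in the
tree's `gamma0Index_le_of_dvd`, re-proved to keep imports light). [folklore] -/
private theorem gamma0Index_le_of_dvd_aux {a b : ℕ} (h : a ∣ b) (hb : b ≠ 0) :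
    gamma0Index a ≤ gamma0Index b := by
  have ha : a ≠ 0 := fun h0 ↦ hb (zero_dvd_iff.mp (h0 ▸ h))
  have hfac : a.factorization ≤ b.factorization := (Nat.factorization_le_iff_dvd ha hb).mpr h
  unfold gamma0Index
  rw [Finsupp.prod, Finsupp.prod, Nat.support_factorization, Nat.support_factorization]
  calc ∏ p ∈ a.primeFactors, p ^ (a.factorization p - 1) * (p + 1)
      ≤ ∏ p ∈ a.primeFactors, p ^ (b.factorization p - 1) * (p + 1) := by
        refine Finset.prod_le_prod (fun p _ ↦ Nat.zero_le _) fun p hp ↦ ?_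
        exact Nat.mul_le_mul_right _ (Nat.pow_le_pow_right (Nat.prime_of_mem_primeFactors hp).pos
          (Nat.sub_le_sub_right (hfac p) 1))
    _ ≤ ∏ p ∈ b.primeFactors, p ^ (b.factorization p - 1) * (p + 1) :=
        Finset.prod_le_prod_of_subset_of_one_le' (Nat.primeFactors_mono h hb)
          fun p _ _ ↦ Nat.one_le_iff_ne_zero.mpr (Nat.mul_ne_zero (pow_ne_zero _
            (Nat.prime_of_mem_primeFactors ‹_›).ne_zero) (Nat.succ_ne_zero p))

/-- `l*(M) ≤ l*(N)` for `M ∣ N` (`N ≥ 1`). [cite: VonkanelMatschke2023, §10.5.1 (proof of Prop. 10.7)] -/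
theorem vkmIndexLStar_le_of_dvd {M N : ℕ} (h : M ∣ N) (hN : N ≠ 0) :
    vkmIndexLStar M ≤ vkmIndexLStar N :=
  Nat.div_le_div_right (gamma0Index_le_of_dvd_aux h hN)

/-- **`g(X₀(M)) ≤ g(X₀(N))` for `M ∣ N`**: `dim S₂(Γ₀(M)) ≤ dim S₂(Γ₀(N))` by the injective inclusion
`S₂(Γ₀(M)) ↪ S₂(Γ₀(N))` (`degeneracyMap0_one_injective`), and `dim S₂(Γ₀(·)) = g(X₀(·))`
(`finrank_cuspForm_two_eq_genusX0_holds`). [cite: DiamondShurman2005, Thm. 3.5.1] -/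
theorem genusX0_le_of_dvd {M N : ℕ} [NeZero M] [NeZero N] (h : M ∣ N) : genusX0 M ≤ genusX0 N := by
  haveI : FiniteDimensional ℂ (CuspForm (Gamma0 N) 2) := finiteDimensional_cuspForm_gamma0 N 2
  have hM : Module.finrank ℂ (CuspForm (Gamma0 M) 2) = genusX0 M :=
    finrank_cuspForm_two_eq_genusX0_holds M
  have hN : Module.finrank ℂ (CuspForm (Gamma0 N) 2) = genusX0 N :=
    finrank_cuspForm_two_eq_genusX0_holds N
  rw [← hM, ← hN]
  exact LinearMap.finrank_le_finrank_of_injective (degeneracyMap0_one_injective M N 2 h)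

/-! ### The `max_J`-term and `x log x` -/

/-- `max_{J ⊆ {1..l}, |J| ≤ m} Σ_J` is monotone in `l` and `m`. [cite: VonkanelMatschke2023, §10.5.1 (def:bb*)] -/
theorem maxLogTauSum_mono {l l' m m' : ℕ} (hl : l ≤ l') (hm : m ≤ m') :
    maxLogTauSum l m ≤ maxLogTauSum l' m' := by
  unfold maxLogTauSum
  refine Finset.sup'_le _ _ fun J hJ ↦ ?_
  obtain ⟨hJsub, hJcard⟩ := Finset.mem_filter.mp hJ
  refine Finset.le_sup'_of_le _ (b := J) ?_ le_rfl
  refine Finset.mem_filter.mpr ⟨?_, hJcard.trans hm⟩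
  rw [Finset.mem_powerset] at hJsub ⊢
  exact hJsub.trans (Finset.Icc_subset_Icc_right hl)

/-- `m log m ≤ m' log m'` for naturals `m ≤ m'`. [folklore] -/
private theorem natCast_mul_log_mono {m m' : ℕ} (h : m ≤ m') :
    (m : ℝ) * Real.log m ≤ (m' : ℝ) * Real.log m' := by
  have hm' : 0 ≤ Real.log (m' : ℝ) := by
    rcases Nat.eq_zero_or_pos m' with rfl | hpos
    · simp
    · exact Real.log_nonneg (by exact_mod_cast hpos)
  rcases Nat.eq_zero_or_pos m with rfl | hpos
  · simp only [Nat.cast_zero, zero_mul]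
    positivity
  · have h1 : (1 : ℝ) ≤ m := by exact_mod_cast hpos
    have h2 : (m : ℝ) ≤ m' := by exact_mod_cast h
    exact mul_le_mul h2 (Real.log_le_log (by linarith) h2) (Real.log_nonneg h1) (by linarith)

/-! ### `β`, `β*`, `α` -/

/-- `β(M) ≤ β(N)` for `M ∣ N` (`N ≥ 1`). [cite: VonkanelMatschke2023, §10.5.1 (proof of Prop. 10.7)] -/
theorem vkmBeta_le_of_dvd {M N : ℕ} (h : M ∣ N) (hN : N ≠ 0) : vkmBeta M ≤ vkmBeta N := by
  unfold vkmBeta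
  have hm := newformCount_le_of_dvd h hN
  have h1 := natCast_mul_log_mono hm
  have h2 := maxLogTauSum_mono (vkmIndexL_le_of_dvd h hN) hm
  linarith

/-- `β*(M) ≤ β*(N)` for `M ∣ N` (`M, N ≥ 1`). [cite: VonkanelMatschke2023, §10.5.1 (proof of Prop. 10.7)] -/
theorem vkmBetaStar_le_of_dvd {M N : ℕ} [NeZero M] [NeZero N] (h : M ∣ N) :
    vkmBetaStar M ≤ vkmBetaStar N := by
  unfold vkmBetaStar
  have hg := genusX0_le_of_dvd h
  have h1 := natCast_mul_log_mono hg
  have h2 := maxLogTauSum_mono (vkmIndexLStar_le_of_dvd h (NeZero.ne N)) hg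
  linarith

/-- **vKM §10.5.1: `α(m) ≤ α(n)` for all `m, n ≥ 1` with `m ∣ n`** — PROVED (`α = min(β, β*)`; every
ingredient is monotone under divisibility, the genus via the inclusion `S₂(Γ₀(m)) ↪ S₂(Γ₀(n))`).
[cite: VonkanelMatschke2023, §10.5.1 (proof of Prop. 10.7: "α(m) ≤ α(n) for m dividing n")] -/
theorem vkmAlpha_le_of_dvd {M N : ℕ} [NeZero M] [NeZero N] (h : M ∣ N) : vkmAlpha M ≤ vkmAlpha N :=
  min_le_min (vkmBeta_le_of_dvd h (NeZero.ne N)) (vkmBetaStar_le_of_dvd h)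

end Literature.NumberTheory.EllipticCurves.ModularForms

end
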